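import Summits.QuantumAdvantage.AdviceFreeQNC0.WalkCharacters
import HarnessLib

/-!
# AffBells37 (1/6) — cube-restricted `𝔽₄` characters of `(ℤ/3)^F` and the KRAFT INEQUALITY

Cell qa-qnc0, route DWalkThree (crux stmt-QuantumAdvantage-22907; rung (NP₁) `AffBells26.AffBellsPolyLoss3`).  AUTHORED AND PROVED BY THE PLANNER qa-qnc0-p2 gen 34 (memo `HOME/qa-qnc0-p2/ROUND-34P2.md`, INBOX P2-34a/b, 2026-08-29); landed verbatim by qn-prover-3.  Part 1/6 of the all-firsts PAIR-SLICING + `𝔽₄`-KRAFT proof of (NP₁); the six parts are a mechanical split (≤ 400 lines each) of one kernel-checked file `AffBells37.lean` (rc 0, 0 sorries, axioms propext/Classical.choice/Quot.sound).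

Letter rows `A ∈ (ℤ/3)^F`, the cube-restricted character `χ_A(u) = ω^{⟨A,u⟩}` (`u ∈ {0,1}^F`, `chiZ`), Hamming weight `wt A`.
* `kraft` — **if `Σ_b c_b χ_{A_b} ≡ 1` on the cube then `Σ_b 2^{F − wt A_b} ≥ 2^F`** (Kraft mass of a representation of `1` is `≥ 1`;
  indexed families, repeats and zero coefficients allowed).  Induction on `F`: the rows with first letter `≠ 2` (resp. `≠ 1`) give a
  representation of `1` in `F − 1` letters (`rep_cons_one/two`, via `φ₁(2) = φ₂(1) = 0`); average the two induction hypotheses (`mass_cons`).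
  Tight: `1 = ω·ω^u + ω²·ω^{2u}`.  `exists_ne_one_of_mass_lt` is the contrapositive used by the assembly (part 6).
WHAT THIS IS NOT: nothing about the game (parts 3–6); no sparsity (part 2).
-/

noncomputable section

namespace Summit.QuantumAdvantage.AdviceFreeQNC0.AffBells37

open Finset F4
open Classical

variable {F : ℕ}

/-! ### Cube-restricted characters of `(ℤ/3)^F` -/

/-- The exponent `⟨A,u⟩ = Σ_i [u_i]·A_i` as a natural number (letters read as `0,1,2`). -/
def expo (A : Fin F → ZMod 3) (u : Fin F → Bool) : ℕ := ∑ i, if u i then (A i).val else 0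

/-- The cube-restricted character `χ_A(u) = ω^{⟨A,u⟩}`. -/
def chiZ (A : Fin F → ZMod 3) (u : Fin F → Bool) : F4 := ω ^ expo A u

/-- Hamming weight of a letter row. -/
def wt (A : Fin F → ZMod 3) : ℕ := (univ.filter fun i => A i ≠ 0).card

/-- The Hamming weight of a row of length `F` is at most `F`. -/
theorem wt_le (A : Fin F → ZMod 3) : wt A ≤ F := by
  unfold wt
  exact (card_filter_le _ _).trans (by rw [card_univ, Fintype.card_fin])

/-- Peeling the first letter: the exponent of `Fin.cons b u` splits off the contribution of coordinate `0`. -/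
theorem expo_cons (A : Fin (F + 1) → ZMod 3) (b : Bool) (u : Fin F → Bool) :
    expo A (Fin.cons b u) = (if b then (A 0).val else 0) + expo (Fin.tail A) u := by
  unfold expo
  rw [Fin.sum_univ_succ]
  simp only [Fin.cons_zero, Fin.cons_succ, Fin.tail]

/-- Peeling the first letter of a cube-restricted character: `χ_A(b ∷ u) = ω^{[b]·A₀} · χ_{tail A}(u)`. -/
theorem chiZ_cons (A : Fin (F + 1) → ZMod 3) (b : Bool) (u : Fin F → Bool) :
    chiZ A (Fin.cons b u) = ω ^ (if b then (A 0).val else 0) * chiZ (Fin.tail A) u := by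
  unfold chiZ
  rw [expo_cons, pow_add]

/-- The weight of a row is `[A₀ ≠ 0]` plus the weight of its tail. -/
theorem wt_succ (A : Fin (F + 1) → ZMod 3) : wt A = (if A 0 = 0 then 0 else 1) + wt (Fin.tail A) := by
  unfold wt
  rw [card_filter, card_filter, Fin.sum_univ_succ]
  congr 1
  by_cases h : A 0 = 0
  · rw [if_pos h, if_neg (not_not.2 h)]
  · rw [if_neg h, if_pos h]

/-! ### The two derived representations -/

/-- `ω + ω²·ω^t` (`= 1, ω², 0` for `t = 0, 1, 2`). -/
def phi1 (t : ZMod 3) : F4 := ω + ω ^ 2 * ω ^ t.val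

/-- `ω² + ω·ω^t` (`= 1, 0, ω` for `t = 0, 1, 2`). -/
def phi2 (t : ZMod 3) : F4 := ω ^ 2 + ω * ω ^ t.val

/-- `φ₁(2) = ω + ω²·ω² = ω + ω = 0`. -/
theorem phi1_two : phi1 2 = 0 := by
  unfold phi1
  rw [show (2 : ZMod 3).val = 2 from rfl, ← pow_add, omega_pow_mod (2 + 2), show (2 + 2) % 3 = 1 from rfl,
    pow_one, add_self]

/-- `φ₂(1) = ω² + ω·ω = 0`. -/
theorem phi2_one : phi2 1 = 0 := by
  unfold phi2
  rw [show (1 : ZMod 3).val = 1 from rfl, pow_one, ← sq, add_self]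

variable {ι : Type*}

/-- `ω·(u₀ = 0) + ω²·(u₀ = 1)`: the rows with first letter `≠ 2` represent `1` in the tail. -/
theorem rep_cons_one (s : Finset ι) (A : ι → Fin (F + 1) → ZMod 3) (c : ι → F4)
    (hrep : ∀ u : Fin (F + 1) → Bool, ∑ b ∈ s, c b * chiZ (A b) u = 1) (u : Fin F → Bool) :
    ∑ b ∈ s.filter (fun b => A b 0 ≠ 2), (c b * phi1 (A b 0)) * chiZ (Fin.tail (A b)) u = 1 := by
  have e0 := hrep (Fin.cons false u)
  have e1 := hrep (Fin.cons true u)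
  simp only [chiZ_cons, Bool.false_eq_true, if_false, if_true, pow_zero, one_mul] at e0 e1
  calc ∑ b ∈ s.filter (fun b => A b 0 ≠ 2), (c b * phi1 (A b 0)) * chiZ (Fin.tail (A b)) u
      = ∑ b ∈ s, (c b * phi1 (A b 0)) * chiZ (Fin.tail (A b)) u := by
        rw [Finset.sum_filter]
        refine Finset.sum_congr rfl fun b _ => ?_
        by_cases h : A b 0 ≠ 2
        · rw [if_pos h]
        · rw [if_neg h, not_not.1 h, phi1_two, mul_zero, zero_mul]
    _ = ω * (∑ b ∈ s, c b * chiZ (Fin.tail (A b)) u)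
          + ω ^ 2 * (∑ b ∈ s, c b * (ω ^ (A b 0).val * chiZ (Fin.tail (A b)) u)) := by
        rw [Finset.mul_sum, Finset.mul_sum, ← Finset.sum_add_distrib]
        refine Finset.sum_congr rfl fun b _ => ?_
        unfold phi1
        ring
    _ = 1 := by rw [e0, e1, mul_one, mul_one, omega_add_omega_sq]

/-- `ω²·(u₀ = 0) + ω·(u₀ = 1)`: the rows with first letter `≠ 1` represent `1` in the tail. -/
theorem rep_cons_two (s : Finset ι) (A : ι → Fin (F + 1) → ZMod 3) (c : ι → F4)
    (hrep : ∀ u : Fin (F + 1) → Bool, ∑ b ∈ s, c b * chiZ (A b) u = 1) (u : Fin F → Bool) :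
    ∑ b ∈ s.filter (fun b => A b 0 ≠ 1), (c b * phi2 (A b 0)) * chiZ (Fin.tail (A b)) u = 1 := by
  have e0 := hrep (Fin.cons false u)
  have e1 := hrep (Fin.cons true u)
  simp only [chiZ_cons, Bool.false_eq_true, if_false, if_true, pow_zero, one_mul] at e0 e1
  calc ∑ b ∈ s.filter (fun b => A b 0 ≠ 1), (c b * phi2 (A b 0)) * chiZ (Fin.tail (A b)) u
      = ∑ b ∈ s, (c b * phi2 (A b 0)) * chiZ (Fin.tail (A b)) u := by
        rw [Finset.sum_filter]
        refine Finset.sum_congr rfl fun b _ => ?_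
        by_cases h : A b 0 ≠ 1
        · rw [if_pos h]
        · rw [if_neg h, not_not.1 h, phi2_one, mul_zero, zero_mul]
    _ = ω ^ 2 * (∑ b ∈ s, c b * chiZ (Fin.tail (A b)) u)
          + ω * (∑ b ∈ s, c b * (ω ^ (A b 0).val * chiZ (Fin.tail (A b)) u)) := by
        rw [Finset.mul_sum, Finset.mul_sum, ← Finset.sum_add_distrib]
        refine Finset.sum_congr rfl fun b _ => ?_
        unfold phi2
        ring
    _ = 1 := by rw [e0, e1, mul_one, mul_one, add_comm, omega_add_omega_sq]

/-- Mass bookkeeping: a nonzero first letter doubles the tail mass. -/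
theorem mass_cons (A : Fin (F + 1) → ZMod 3) :
    (if A 0 ≠ 2 then 2 * 2 ^ (F - wt (Fin.tail A)) else 0)
      + (if A 0 ≠ 1 then 2 * 2 ^ (F - wt (Fin.tail A)) else 0) = 2 * 2 ^ (F + 1 - wt A) := by
  have hle := wt_le (Fin.tail A)
  have h3 : ∀ t : ZMod 3, t = 0 ∨ t = 1 ∨ t = 2 := by decide
  rw [wt_succ]
  rcases h3 (A 0) with h | h | h <;> rw [h]
  · rw [if_pos (by decide), if_pos (by decide), if_pos rfl, Nat.zero_add,
      show F + 1 - wt (Fin.tail A) = (F - wt (Fin.tail A)) + 1 by omega, pow_succ]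
    ring
  · rw [if_pos (by decide), if_neg (by decide), if_neg (by decide), Nat.add_zero,
      show F + 1 - (1 + wt (Fin.tail A)) = F - wt (Fin.tail A) by omega]
  · rw [if_neg (by decide), if_pos (by decide), if_neg (by decide), Nat.zero_add,
      show F + 1 - (1 + wt (Fin.tail A)) = F - wt (Fin.tail A) by omega]

/-! ### The Kraft inequality -/

/-- **Kraft inequality for representations of `1`.**  If `Σ_{b ∈ s} c_b · χ_{A_b}(u) = 1` for every
`u ∈ {0,1}^F` then `Σ_{b ∈ s} 2^{F − wt A_b} ≥ 2^F` (i.e. `Σ_b 2^{−wt A_b} ≥ 1`). -/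
theorem kraft (F : ℕ) (s : Finset ι) (A : ι → Fin F → ZMod 3) (c : ι → F4)
    (hrep : ∀ u : Fin F → Bool, ∑ b ∈ s, c b * chiZ (A b) u = 1) :
    2 ^ F ≤ ∑ b ∈ s, 2 ^ (F - wt (A b)) := by
  induction F generalizing s c with
  | zero =>
    have hne : s.Nonempty := by
      rw [Finset.nonempty_iff_ne_empty]
      rintro rfl
      have h := hrep fun i => i.elim0
      rw [Finset.sum_empty] at h
      haveI := F4.nontrivial
      exact zero_ne_one h
    simp only [Nat.zero_sub, pow_zero, Finset.sum_const, smul_eq_mul, mul_one]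
    exact hne.card_pos
  | succ F ih =>
    have i1 := ih (s.filter fun b => A b 0 ≠ 2) (fun b => Fin.tail (A b)) (fun b => c b * phi1 (A b 0))
      (rep_cons_one s A c hrep)
    have i2 := ih (s.filter fun b => A b 0 ≠ 1) (fun b => Fin.tail (A b)) (fun b => c b * phi2 (A b 0))
      (rep_cons_two s A c hrep)
    have hsum : (∑ b ∈ s.filter (fun b => A b 0 ≠ 2), 2 * 2 ^ (F - wt (Fin.tail (A b))))
        + (∑ b ∈ s.filter (fun b => A b 0 ≠ 1), 2 * 2 ^ (F - wt (Fin.tail (A b))))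
        = 2 * ∑ b ∈ s, 2 ^ (F + 1 - wt (A b)) := by
      rw [Finset.sum_filter, Finset.sum_filter, ← Finset.sum_add_distrib, Finset.mul_sum]
      exact Finset.sum_congr rfl fun b _ => mass_cons (A b)
    have j1 : 2 * 2 ^ F ≤ ∑ b ∈ s.filter (fun b => A b 0 ≠ 2), 2 * 2 ^ (F - wt (Fin.tail (A b))) := by
      rw [← Finset.mul_sum]; exact Nat.mul_le_mul_left 2 i1
    have j2 : 2 * 2 ^ F ≤ ∑ b ∈ s.filter (fun b => A b 0 ≠ 1), 2 * 2 ^ (F - wt (Fin.tail (A b))) := by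
      rw [← Finset.mul_sum]; exact Nat.mul_le_mul_left 2 i2
    have j := Nat.add_le_add j1 j2
    rw [hsum] at j
    rw [pow_succ]
    omega

/-- The same in `ℝ`: the Kraft mass `Σ_b 2^{−wt A_b}` of a representation of `1` is `≥ 1`. -/
theorem kraft_real (F : ℕ) (s : Finset ι) (A : ι → Fin F → ZMod 3) (c : ι → F4)
    (hrep : ∀ u : Fin F → Bool, ∑ b ∈ s, c b * chiZ (A b) u = 1) :
    (1 : ℝ) ≤ ∑ b ∈ s, (1 / 2 : ℝ) ^ wt (A b) := by
  have h := kraft F s A c hrep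
  have hpos : (0 : ℝ) < 2 ^ F := by positivity
  have hcast : ((2 ^ F : ℕ) : ℝ) ≤ ((∑ b ∈ s, 2 ^ (F - wt (A b)) : ℕ) : ℝ) := by exact_mod_cast h
  push_cast at hcast
  have key : ∀ b ∈ s, ((2 : ℝ) ^ (F - wt (A b))) = 2 ^ F * (1 / 2 : ℝ) ^ wt (A b) := by
    intro b _
    have hle := wt_le (A b)
    rw [one_div, inv_pow, ← div_eq_mul_inv, eq_div_iff (by positivity), ← pow_add, Nat.sub_add_cancel hle]
  rw [Finset.sum_congr rfl key, ← Finset.mul_sum] at hcast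
  nlinarith

/-- Contrapositive used downstream: Kraft mass `< 1` (i.e. `Σ_b 2^{F − wt A_b} < 2^F`) ⇒ the
represented function is not the constant `1`: some point of the cube is missed. -/
theorem exists_ne_one_of_mass_lt (F : ℕ) (s : Finset ι) (A : ι → Fin F → ZMod 3) (c : ι → F4)
    (hmass : ∑ b ∈ s, 2 ^ (F - wt (A b)) < 2 ^ F) :
    ∃ u : Fin F → Bool, ∑ b ∈ s, c b * chiZ (A b) u ≠ 1 := by
  by_contra h
  push Not at h
  exact absurd (kraft F s A c h) (not_le.2 hmass)

end Summit.QuantumAdvantage.AdviceFreeQNC0.AffBells37
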